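import Summits.BirchSwinnertonDyer.BirchSwinnertonDyer.Theorems.PrintX8VSOneColourMuAnX8
import Summits.BirchSwinnertonDyer.Rank1Residual.Supersingular.SharpFlatRankZeroReal
import Literature.NumberTheory.EllipticCurves.Sprung2017.HalfLogarithmMatrixTwistProofs
import Literature.NumberTheory.EllipticCurves.Sprung2017.TraceCoordinateFunctionalEquation
import Literature.Barriers.BirchSwinnertonDyer.PAdicFunctionalEquationParity
import Literature.NumberTheory.EllipticCurves.PAdicLFunctionInvolutionProofs
import Literature.NumberTheory.EllipticCurves.CuspFormLFunctionNewformFrickeProofs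
import Literature.NumberTheory.EllipticCurves.PAdicLFunctionNonvanishingProofs
import Literature.NumberTheory.EllipticCurves.PAdicLFunctionNeZeroProofs
import HarnessLib

/-!
# Crux `SprungLowerDivisibilityAtThree` (stmt-BirchSwinnertonDyer-19875), line `chromatic-common-zeros`,
# stub S0 `stub_bothColours`: BOTH colours `L♯, L♭ ≠ 0` on class X8, CLASS-WIDE (any rank, image, level),
# from the trace-coordinate functional equation (Sprung 2017 Thm. 1.1 + Thm. 4.13 / MTT §I.17) — i.e.
# Sprung 2017 Conj. 4.12 / 2012 Conj. 6.15 at `(3, ±3)` modulo that one printed fact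

Cell `bsd-ssimc` (host) / width seat `cruxlead-stmt-BirchSwinnertonDyer-19875-w3` (gen 2); crux idea card
`Cruxes/SprungLowerDivisibilityAtThree/Ideas/fe-chromatic-twist.md` (cruxidea seat 1 gen 5); `--supports`
19875; theorems only; CONDITIONAL on ONE named fact; closes nothing by itself: K1 / BSD / leaf X8 are NOT
proved by anything here.

THE ARGUMENT ("the ♯/♭ functional equation is colour-MIXING at `a_3 = ±3`"). Let `ℒ = halfLogMatrix b`
(`a_3 = 3b`, `b = ±1`) be the α-free half-logarithm matrix (`Log_{α,β} = ℒ·(−1 −1; β α)`, Sprung 2017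
§3.1; tree DEFINITION, coefficientwise `3`-adic limit) and `ι = T^ι = (1+T)⁻¹ − 1`. The trace coordinates
`G_j := L♯ℒ_{0j} + L♭ℒ_{1j}` are constant combinations of `L_α, L_β`, so BOTH satisfy the scalar functional
equation `G_j(T^ι) = σ(1+T)^c G_j(T)` (the named fact `thm413_traceCoordinate_functionalEquation_three`).
If `L♭ = 0` then `G_j = L♯ℒ_{0j}` and the two equations force the `♯`-row of `ℒ` to be projectively
`ι`-invariant: `ℒ_{00}·ℒ_{01}(ι) − ℒ_{01}·ℒ_{00}(ι) = 0` — but this ROW TWIST has `T`-coefficient `±1/21 ≠ 0`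
(`rowTwist_halfLogMatrix_ne_zero`, PROVED: `ℒ(0) = C^{−2}`, `ℒ′(0)` in closed form via `C⁶ = −27`).
Symmetrically `L♯ = 0` is excluded by the `♭`-row twist (`±3/7`). That not both vanish is THEOREM B of
the x8 cell (`ClassX8.oneColourMuAn`, input-free). At `a_p = 0` the twists vanish identically (Pollack's
`log^±`: each colour has its own functional equation) — the lever exists exactly because `a_3 ≠ 0`.

Inputs BY NAME: `hF : thm413_traceCoordinate_functionalEquation_three` (statement-only Literature fact,
Sprung 2017 Thm. 1.1 + 4.13, MTT §I.17; its `a_p = 0` analogue `cor414_sharpFlat_functionalEquation_apZero`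
is PROVED at `p = 2` in the tree). Everything else is a tree theorem: THEOREM B, the newform's Fricke sign
(`IsNewform0.frickeInvolution_eq_smul_holds`, `…frickeEigenvalue_eq_one_or_eq_neg_one_holds`), the
Teichmüller exponent of `N` (`exists_teichmuller_exponent_natCast`), the involution `invOnePlusSubOne`.
-/

set_option linter.dupNamespace false
set_option autoImplicit false

noncomputable section

open scoped Classical MatrixGroups ModularForm

open CongruenceSubgroup WeierstrassCurve PowerSeries
  Literature.NumberTheory.EllipticCurves Literature.NumberTheory.EllipticCurves.ModularForms
  Literature.NumberTheory.EllipticCurves.Sprung2017 Literature.NumberTheory.EllipticCurves.Rank1Residual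
  Literature.Barriers.BirchSwinnertonDyer
  Summit.BirchSwinnertonDyer.Rank1Residual.Supersingular
  Summit.BirchSwinnertonDyer.BirchSwinnertonDyer.Theorems

namespace Summit.BirchSwinnertonDyer.BirchSwinnertonDyer.Theorems.ChromaticBothColours

/-! ## §1 The algebraic kernel: one colour carrying both trace coordinates forces a vanishing row twist -/

/-- **Twist criterion.** In a domain: if `X·A₀ = κ·Y·B₀` and `X·A₁ = κ·Y·B₁` with `X ≠ 0`, then
`B₀·A₁ − B₁·A₀ = 0` (cross-multiply). [folklore] -/
theorem twist_eq_zero_of_fe {R : Type*} [CommRing R] [IsDomain R] {X Y κ A₀ A₁ B₀ B₁ : R} (hX : X ≠ 0)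
    (h₀ : X * A₀ = κ * Y * B₀) (h₁ : X * A₁ = κ * Y * B₁) : B₀ * A₁ - B₁ * A₀ = 0 := by
  have key : X * (B₀ * A₁ - B₁ * A₀) = 0 := by linear_combination B₀ * h₁ - B₁ * h₀
  exact (mul_eq_zero.mp key).resolve_left hX

/-! ## §2 S0 on class X8 from the trace-coordinate functional equation -/

/-- The involution `ι = (1+T)⁻¹ − 1 ∈ ℚ_3⟦T⟧` is injective as a substitution (`ι(ι(T)) = T`). [folklore] -/
theorem subst_invOnePlusSubOne_injective :
    Function.Injective (fun g : PowerSeries ℚ_[3] =>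
      (PowerSeries.subst (invOnePlusSubOne : PowerSeries ℚ_[3]) g : PowerSeries ℚ_[3])) := by
  intro g h hgh
  have hι := hasSubst_invOnePlusSubOne (R := ℚ_[3])
  have hinv : ∀ f : PowerSeries ℚ_[3], PowerSeries.subst (invOnePlusSubOne : PowerSeries ℚ_[3])
      (PowerSeries.subst (invOnePlusSubOne : PowerSeries ℚ_[3]) f) = f := by
    intro f
    rw [PowerSeries.subst_comp_subst_apply hι hι, invOnePlusSubOne_subst_self, PowerSeries.X_subst]
  rw [← hinv g, ← hinv h]
  exact congrArg (fun f : PowerSeries ℚ_[3] =>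
    (PowerSeries.subst (invOnePlusSubOne : PowerSeries ℚ_[3]) f : PowerSeries ℚ_[3])) hgh

/-- **S0 for one colour from the other**: in the setting of the named fact at an X8 pair, if one colour
of a Sprung pair vanished, the corresponding row twist of `ℒ(3, ±3)` would vanish — which it does not.
Packaged as `(L♯ ≠ 0 ∨ L♭ ≠ 0) → L♯ ≠ 0 ∧ L♭ ≠ 0` under the two trace-coordinate functional equations.
[cite: Sprung2017, Thm. 1.1, Thm. 4.13, Cor. 4.6 and Conj. 4.12] -/
theorem both_ne_zero_of_traceFE_of_or {b : ℤ} (hb : b = 1 ∨ b = -1) {σ : ℤ} {c : ℤ_[3]}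
    {Ls Lf : IwasawaAlgebra 3}
    (hFE : ∀ j : Fin 2,
      PowerSeries.subst (invOnePlusSubOne : PowerSeries ℚ_[3])
          (iwasawaToPowerSeries 3 Ls * halfLogMatrix b 0 j + iwasawaToPowerSeries 3 Lf * halfLogMatrix b 1 j) =
        (σ : PowerSeries ℚ_[3]) * (PowerSeries.binomialSeries ℤ_[3] c).map (algebraMap ℤ_[3] ℚ_[3]) *
          (iwasawaToPowerSeries 3 Ls * halfLogMatrix b 0 j + iwasawaToPowerSeries 3 Lf * halfLogMatrix b 1 j))
    (hor : Ls ≠ 0 ∨ Lf ≠ 0) : Ls ≠ 0 ∧ Lf ≠ 0 := by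
  have hι : (1 + PowerSeries.X : PowerSeries ℚ_[3]) * (invOnePlusSubOne + 1) = 1 :=
    one_add_X_mul_invOnePlusSubOne_add_one
  have hsub := hasSubst_invOnePlusSubOne (R := ℚ_[3])
  set κ : PowerSeries ℚ_[3] :=
    (σ : PowerSeries ℚ_[3]) * (PowerSeries.binomialSeries ℤ_[3] c).map (algebraMap ℤ_[3] ℚ_[3]) with hκ
  -- a non-zero colour stays non-zero under `Λ ↪ ℚ_3⟦T⟧` and the involution
  have hne : ∀ L : IwasawaAlgebra 3, L ≠ 0 →
      PowerSeries.subst (invOnePlusSubOne : PowerSeries ℚ_[3]) (iwasawaToPowerSeries 3 L) ≠ 0 := by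
    intro L hL h0
    have h1 : PowerSeries.subst (invOnePlusSubOne : PowerSeries ℚ_[3]) (iwasawaToPowerSeries 3 L) =
        PowerSeries.subst (invOnePlusSubOne : PowerSeries ℚ_[3]) (0 : PowerSeries ℚ_[3]) := by
      rw [h0, ← PowerSeries.coe_substAlgHom hsub, map_zero]
    exact hL (iwasawaToPowerSeries_injective 3 (by
      rw [map_zero]; exact subst_invOnePlusSubOne_injective h1))
  have flat : Lf ≠ 0 := by
    intro hf0
    have hs : Ls ≠ 0 := hor.resolve_right (not_ne_iff.mpr hf0)
    have h := fun j => hFE j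
    simp only [hf0, map_zero, zero_mul, add_zero, PowerSeries.subst_mul hsub] at h
    have e0 : PowerSeries.subst invOnePlusSubOne (iwasawaToPowerSeries 3 Ls) *
        PowerSeries.subst invOnePlusSubOne (halfLogMatrix b 0 0) =
          κ * iwasawaToPowerSeries 3 Ls * halfLogMatrix b 0 0 := by rw [h 0]; ring
    have e1 : PowerSeries.subst invOnePlusSubOne (iwasawaToPowerSeries 3 Ls) *
        PowerSeries.subst invOnePlusSubOne (halfLogMatrix b 0 1) =
          κ * iwasawaToPowerSeries 3 Ls * halfLogMatrix b 0 1 := by rw [h 1]; ring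
    exact rowTwist_halfLogMatrix_ne_zero hb hι 0 (twist_eq_zero_of_fe (hne Ls hs) e0 e1)
  have sharp : Ls ≠ 0 := by
    intro hs0
    have hf : Lf ≠ 0 := hor.resolve_left (not_ne_iff.mpr hs0)
    have h := fun j => hFE j
    simp only [hs0, map_zero, zero_mul, zero_add, PowerSeries.subst_mul hsub] at h
    have e0 : PowerSeries.subst invOnePlusSubOne (iwasawaToPowerSeries 3 Lf) *
        PowerSeries.subst invOnePlusSubOne (halfLogMatrix b 1 0) =
          κ * iwasawaToPowerSeries 3 Lf * halfLogMatrix b 1 0 := by rw [h 0]; ring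
    have e1 : PowerSeries.subst invOnePlusSubOne (iwasawaToPowerSeries 3 Lf) *
        PowerSeries.subst invOnePlusSubOne (halfLogMatrix b 1 1) =
          κ * iwasawaToPowerSeries 3 Lf * halfLogMatrix b 1 1 := by rw [h 1]; ring
    exact rowTwist_halfLogMatrix_ne_zero hb hι 1 (twist_eq_zero_of_fe (hne Lf hf) e0 e1)
  exact ⟨sharp, flat⟩

/-- **STUB S0 `stub_bothColours` — BOTH COLOURS ARE NON-ZERO ON CLASS X8, CLASS-WIDE** (Sprung 2017
Conj. 4.12 / 2012 Conj. 6.15 at `(p, a_p) = (3, ±3)`: for every X8 pair `(E, 3)`, its newform `f` and every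
Sprung pair `(L♯, L♭)`, `L♯ ≠ 0 ∧ L♭ ≠ 0` — any analytic rank, any `3`-adic image, any conductor), GRANTED
BY NAME the trace-coordinate functional equation `thm413_traceCoordinate_functionalEquation_three` (Sprung
2017 Thm. 1.1 + Thm. 4.13, Mazur–Tate–Teitelbaum §I.17; statement-only Literature fact). Proof: `a_3 = 3b`,
`b = ±1` (`ClassX8.frobeniusTrace_eq_three_or`); the newform's Fricke sign `σ` and the Teichmüller exponent
`c` of the level are tree theorems; the fact gives the two scalar functional equations of the trace
coordinates; THEOREM B (`ClassX8.oneColourMuAn`, input-free) gives one non-zero colour; and a vanishing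
colour would kill a row twist of `ℒ(3, ±3)`, contradicting `rowTwist_halfLogMatrix_ne_zero` (`±1/21`,
`±3/7`). The statement is the registered v6 stub `stub_bothColours` of `Lines/chromatic_common_zeros.lean`
(= x8 child C3 `ChromaticBothColoursPosRankX8` without its rank binder) behind the single hypothesis `hF`.
CONDITIONAL on `hF`; closes nothing by itself. [cite: Sprung2017, Conj. 4.12, Thm. 1.1, Thm. 4.13, Cor. 4.14]
[cite: MazurTateTeitelbaum1986Invent, §I.17] -/
theorem ClassX8.sharp_ne_zero_and_flat_ne_zero_of_traceFE
    (hF : thm413_traceCoordinate_functionalEquation_three) :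
    ∀ (W : WeierstrassCurve ℚ) [W.IsElliptic] [W.IsGloballyMinimal] (p : ℕ) [Fact p.Prime],
      ClassX8 W p → ∀ (N : ℕ) (_ : NeZero N) (f : CuspForm (Gamma0 N) 2)
        (Lsharp Lflat : IwasawaAlgebra p),
      IsNewformOf W f → IsSprungPair f p (W.frobeniusTrace p) Lsharp Lflat →
      Lsharp ≠ 0 ∧ Lflat ≠ 0 := by
  intro W _ _ p _ hX N hN f Lsharp Lflat hf hSP
  obtain ⟨hp3, ⟨hgood, -⟩, -⟩ := id hX
  subst hp3
  haveI : NeZero N := hN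
  -- `a_3 = 3b`, `b = ±1`
  obtain ⟨b, hb, hab⟩ : ∃ b : ℤ, (b = 1 ∨ b = -1) ∧ W.frobeniusTrace 3 = 3 * b := by
    rcases ClassX8.frobeniusTrace_eq_three_or W 3 hX with h | h
    · exact ⟨1, Or.inl rfl, by rw [h]; norm_num⟩
    · exact ⟨-1, Or.inr rfl, by rw [h]; norm_num⟩
  rw [hab] at hSP
  -- the Fricke sign of the newform
  have hsm := IsNewform0.frickeInvolution_eq_smul_holds (N := N) (k := (2 : ℤ)) hf.1
  have hFr : IsFrickeEigen N f (frickeEigenvalue f) := isFrickeEigen_of_frickeInvolution_eq_smul N hsm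
  obtain ⟨σ, hσ, hW⟩ : ∃ σ : ℤ, σ ^ 2 = 1 ∧ IsFrickeEigen N f (-(σ : ℂ)) := by
    rcases IsNewform0.frickeEigenvalue_eq_one_or_eq_neg_one_holds (N := N) (k := (2 : ℤ)) hf.1 with h1 | h1
    · refine ⟨-1, by norm_num, ?_⟩
      have : (-((-1 : ℤ) : ℂ)) = frickeEigenvalue f := by rw [h1]; push_cast; ring
      rw [this]; exact hFr
    · refine ⟨1, by norm_num, ?_⟩
      have : (-((1 : ℤ) : ℂ)) = frickeEigenvalue f := by rw [h1]; push_cast; ring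
      rw [this]; exact hFr
  -- the Teichmüller exponent of the level (`3 ∤ N`)
  have hpN : ¬ 3 ∣ N := not_dvd_level_of_isNewformOf hf hgood
  obtain ⟨ηN, c, hc⟩ := exists_teichmuller_exponent_natCast (p := 3) hpN
  -- the functional equation of the trace coordinates, and THEOREM B
  have hFE := hF W N f b hb hf hgood hab σ hσ hW ηN c hc invOnePlusSubOne
    one_add_X_mul_invOnePlusSubOne_add_one Lsharp Lflat hSP
  have hor : Lsharp ≠ 0 ∨ Lflat ≠ 0 := by
    obtain ⟨col₀, hcol₀, -⟩ :=
      PrintX8VSOneColourMuAnX8.ClassX8.oneColourMuAn W 3 hX N hN f Lsharp Lflat hf (hab ▸ hSP)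
    cases col₀ with
    | sharp => exact Or.inl hcol₀
    | flat => exact Or.inr hcol₀
  exact both_ne_zero_of_traceFE_of_or hb hFE hor

/-- **The crux's guard is a theorem on X8 (modulo the fact)**: for every colour `•`,
`chromaticL • L♯ L♭ ≠ 0` — the hypothesis `L^• ≠ 0` of `Theorems.SprungSharpFlatLowerDivisibility W 3 •` is
always met on class X8 (cf. Disproof.lean `withoutGuard_of_lowerDivisibility_of_ne_zero`).
[cite: Sprung2017, Conj. 4.12 and Thm. 4.13] -/
theorem ClassX8.chromaticL_ne_zero_of_traceFE (hF : thm413_traceCoordinate_functionalEquation_three)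
    (W : WeierstrassCurve ℚ) [W.IsElliptic] [W.IsGloballyMinimal] (p : ℕ) [Fact p.Prime] (hX : ClassX8 W p)
    {N : ℕ} [hN : NeZero N] (f : CuspForm (Gamma0 N) 2) (Lsharp Lflat : IwasawaAlgebra p)
    (hf : IsNewformOf W f) (hSP : IsSprungPair f p (W.frobeniusTrace p) Lsharp Lflat) (col : Chroma) :
    chromaticL col Lsharp Lflat ≠ 0 := by
  obtain ⟨hs, hfl⟩ := ClassX8.sharp_ne_zero_and_flat_ne_zero_of_traceFE hF W p hX N hN f Lsharp Lflat hf hSP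
  cases col with
  | sharp => exact hs
  | flat => exact hfl

end Summit.BirchSwinnertonDyer.BirchSwinnertonDyer.Theorems.ChromaticBothColours

end
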